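import Mathlib
import HarnessLib
import Literature.Computability.AlgebraicComplexity.PatternExpressions
import Summits.ValiantsHypothesis.ValiantsHypothesis.Theorems.MonotoneRestorationOrbitRestorationQPHomSpan
import Summits.ValiantsHypothesis.ValiantsHypothesis.Theorems.MonotoneRestorationOrbitCompressionQPTwoSortedPassage
import Summits.ValiantsHypothesis.ValiantsHypothesis.Theorems.MonotoneRestorationOrbitCompressionQPDiClosedOfInvariant

/-!
# Route MonotoneRestoration — aside `OrbitCompressionQP` (stmt-ValiantsHypothesis-18332), line
# `expression_compression`: SHORT closed pattern expressions from homomorphism-polynomial spans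

The second stub `stub_narrowExpressionCompression` of `Cruxes/OrbitCompressionQP/Lines/expression_compression.lean`
asks for closed labelled pattern expressions of quasi-polynomial LENGTH (`PatternExpr.length`).  The tree's
existence theorems for closed expressions (`HomSpan.exists_close_eq_of_matrixSymmetric`,
`OrbitRestorationQPHomPolyClose.exists_close_eq_homPoly`, the `exists_close_eq_add/smul` algebra) carry no
length bookkeeping.  This file supplies the length-tracking MACHINE used by the floors of that stub
(`Theorems/…OrbitCompressionQPCompressionFloors.lean`):

* length calculus — `close_foldr_add`, `length_foldr_add`, `exists_close_eq_sum_smul`: a finite sum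
  `Σ_{i ∈ s} c_i • close (g i)` is `close e` with `|e| = Σ_{i ∈ s} (|g i| + 3) + 1`;
* `exists_close_eq_homPoly` — the ALL-LABELLED product expression: `hom_{E,n}` of a pattern on `Fin r × Fin s`
  is `close t` with `t : PatternExpr _ r s`, `|t| ≤ 2|E| + 1` (every vertex a label, no summing out);
* `homPoly_map_castLE` — padding a pattern with isolated vertices rescales `hom_{·,n}` by a power of `n`;
* `exists_short_close_of_mem_span` — THE MACHINE: a polynomial in the `ℂ`-span of the `hom_{F,n}` of patterns
  with `≤ r` row vertices, `≤ s` column vertices and `≤ d` edges (`n ≥ 1`) is `close e` with `r` row labels,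
  `s` column labels and `|e| ≤ (d+1)^{rs} · (2·rsd + 4) + 1` — finite index type of multiplicity functions
  `Fin r × Fin s → Fin (d+1)` and `Submodule.mem_span_range_iff_exists_fun`, no linear independence needed;
* `exists_short_close_of_matrixSymmetric` (fed by `HomSpan.mem_span_homPoly_of_matrixSymmetric`, DPS26 §8:
  `d + d` labels, `d ≥ deg p`) and `exists_short_close_of_rows_cols_le` (fed by
  `TwoSortedPassage.mem_span_homPoly_of_rows_cols_le`: `r + s` labels for monomials on `≤ r` rows, `≤ s` columns).

Helper file (`--supports stmt-ValiantsHypothesis-18332`); def-free; nothing here is a named fact; no circuit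
and no `VP` hypothesis occurs; VP ≠ VNP is not moved.
-/

noncomputable section

open MvPolynomial

-- `Summit.ValiantsHypothesis.ValiantsHypothesis.…` is the tree's single-conjunct layout (Sub = Summit).
set_option linter.dupNamespace false

namespace Summit.ValiantsHypothesis.ValiantsHypothesis.Theorems

namespace ShortClose

open Literature.Computability.AlgebraicComplexity
/-! ### Length calculus: big sums of expressions -/

section Calculus

variable {F : Type} [CommSemiring F] {k l : ℕ}

/-- `close` is additive. [folklore] -/
theorem close_add (n : ℕ) (e₁ e₂ : PatternExpr F k l) :
    (PatternExpr.add e₁ e₂).close n = e₁.close n + e₂.close n := by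
  simp only [PatternExpr.close, PatternExpr.value_add, Finset.sum_add_distrib]

/-- `close (const c · e) = c • close e`. [folklore] -/
theorem close_const_mul (n : ℕ) (c : F) (e : PatternExpr F k l) :
    (PatternExpr.mul (PatternExpr.const c) e).close n = c • e.close n := by
  simp only [PatternExpr.close, PatternExpr.value_mul, PatternExpr.value_const, Finset.smul_sum,
    MvPolynomial.smul_eq_C_mul]

/-- The closed polynomial of the zero constant is `0`. [folklore] -/
theorem close_const_zero (n : ℕ) : (PatternExpr.const (0 : F) : PatternExpr F k l).close n = 0 := by
  simp [PatternExpr.close]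

/-- **Big sums, semantics**: folding `add` over a list sums the closed polynomials. [folklore] -/
theorem close_foldr_add (n : ℕ) (es : List (PatternExpr F k l)) :
    (es.foldr PatternExpr.add (PatternExpr.const 0)).close n = (es.map fun e => e.close n).sum := by
  induction es with
  | nil => simpa using close_const_zero (k := k) (l := l) n
  | cons e es ih => rw [List.foldr_cons, close_add, ih, List.map_cons, List.sum_cons]

/-- **Big sums, length**: folding `add` over a list costs the lengths plus one per summand plus one. [folklore] -/
theorem length_foldr_add (es : List (PatternExpr F k l)) :
    (es.foldr PatternExpr.add (PatternExpr.const 0)).length = (es.map PatternExpr.length).sum + es.length + 1 := by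
  induction es with
  | nil => simp [PatternExpr.length]
  | cons e es ih =>
    rw [List.foldr_cons, PatternExpr.length, ih, List.map_cons, List.sum_cons, List.length_cons]
    ring

/-- **Finite sums of scaled closed expressions are closed expressions**, with the length bookkeeping:
`Σ_{i ∈ s} c_i • close (g i) = close e` with `|e| = Σ_{i ∈ s} (|g i| + 3) + 1`. [folklore] -/
theorem exists_close_eq_sum_smul {ι : Type*} (s : Finset ι) (c : ι → F) (g : ι → PatternExpr F k l) (n : ℕ) :
    ∃ e : PatternExpr F k l, e.close n = ∑ i ∈ s, c i • (g i).close n ∧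
      e.length = ∑ i ∈ s, ((g i).length + 3) + 1 := by
  classical
  refine ⟨(s.toList.map fun i => PatternExpr.mul (PatternExpr.const (c i)) (g i)).foldr PatternExpr.add
    (PatternExpr.const 0), ?_, ?_⟩
  · rw [close_foldr_add, List.map_map, ← Finset.sum_map_toList s]
    congr 1
    refine List.map_congr_left fun i _ => ?_
    simp only [Function.comp_apply, close_const_mul]
  · rw [length_foldr_add, List.map_map, List.length_map, Finset.length_toList, ← Finset.sum_map_toList s,
      Finset.card_eq_sum_ones, ← Finset.sum_map_toList s]
    have : ∀ L : List ι, (L.map (PatternExpr.length ∘ fun i => PatternExpr.mul (PatternExpr.const (c i)) (g i))).sum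
        + (L.map fun _ => 1).sum + 1 = (L.map fun i => (g i).length + 3).sum + 1 := by
      intro L
      induction L with
      | nil => simp
      | cons i L ih =>
        simp only [List.map_cons, List.sum_cons, Function.comp_apply, PatternExpr.length] at ih ⊢
        omega
    exact this _

end Calculus

/-! ### The all-labelled product expression of a pattern -/

section Product

variable {F : Type} [CommSemiring F] {r s : ℕ}

/-- **All-labelled product expression**: for a list of edges on `Fin r × Fin s` there is an expression with
`r` row and `s` column labels, of length `≤ 2·|L| + 1`, whose value at `(ρ, γ)` is `∏_{(a,b) ∈ L} x_{ρ a, γ b}`.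
[folklore] -/
theorem exists_value_eq_prod (L : List (Fin r × Fin s)) :
    ∃ t : PatternExpr F r s, t.length ≤ 2 * L.length + 1 ∧
      ∀ (n : ℕ) (ρ : Fin r → Fin n) (γ : Fin s → Fin n),
        t.value n ρ γ = (L.map fun e => (X (ρ e.1, γ e.2) : MvPolynomial (Fin n × Fin n) F)).prod := by
  induction L with
  | nil => exact ⟨PatternExpr.const 1, by simp [PatternExpr.length], fun n ρ γ => by simp⟩
  | cons e L ih =>
    obtain ⟨t, ht, hv⟩ := ih
    refine ⟨PatternExpr.mul (PatternExpr.edge e.1 e.2) t, ?_, fun n ρ γ => ?_⟩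
    · simp only [PatternExpr.length, List.length_cons]
      omega
    · rw [PatternExpr.value_mul, PatternExpr.value_edge, hv, List.map_cons, List.prod_cons]

/-- **Homomorphism polynomials of fully labelled patterns are short closed expressions**: for `E` on
`Fin r × Fin s`, `hom_{E,n} = close t` with `t` of length `≤ 2|E| + 1` (`r` row labels, `s` column labels).
[cite: DawarPagoSeppelt2025, §5] -/
theorem exists_close_eq_homPoly (E : Multiset (Fin r × Fin s)) (n : ℕ) :
    ∃ t : PatternExpr F r s, t.length ≤ 2 * Multiset.card E + 1 ∧ t.close n = homPoly E n F := by
  classical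
  obtain ⟨t, ht, hv⟩ := exists_value_eq_prod (F := F) E.toList
  refine ⟨t, by simpa [Multiset.length_toList] using ht, ?_⟩
  rw [PatternExpr.close, homPoly, Fintype.sum_prod_type]
  refine Finset.sum_congr rfl fun ρ _ => Finset.sum_congr rfl fun γ _ => ?_
  rw [hv]
  conv_rhs => rw [← Multiset.coe_toList E]
  rw [Multiset.map_coe, Multiset.prod_coe]

end Product

/-! ### Padding a pattern with isolated vertices rescales its homomorphism polynomial -/

section Padding

variable {F : Type} [CommSemiring F]

/-- **Padding**: pushing a pattern on `Fin a × Fin b` into `Fin r × Fin s` along the initial-segment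
embeddings (`a ≤ r`, `b ≤ s`; the new vertices are isolated) multiplies `hom_{·,n}` by `n^{r-a} · n^{s-b}`.
[cite: DwivediPagoSeppelt2026, eq. (1)] -/
theorem homPoly_map_castLE {a b r s : ℕ} (ha : a ≤ r) (hb : b ≤ s) (E : Multiset (Fin a × Fin b)) (n : ℕ) :
    homPoly (E.map fun e => (Fin.castLE ha e.1, Fin.castLE hb e.2)) n F =
      (n ^ (r - a) * n ^ (s - b)) • homPoly E n F := by
  classical
  unfold homPoly
  simp only [Multiset.map_map, Function.comp_def]
  rw [Fintype.sum_prod_type, Fintype.sum_prod_type]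
  have h1 : ∀ ρ : Fin r → Fin n,
      (∑ γ : Fin s → Fin n, (E.map fun e => (X (ρ (Fin.castLE ha e.1), γ (Fin.castLE hb e.2)) :
          MvPolynomial (Fin n × Fin n) F)).prod) =
        n ^ (s - b) • ∑ γ' : Fin b → Fin n, (E.map fun e => (X ((ρ ∘ Fin.castLE ha) e.1, γ' e.2) :
          MvPolynomial (Fin n × Fin n) F)).prod := by
    intro ρ
    rw [← OrbitSupport.sum_comp_castLE hb (fun γ' : Fin b → Fin n =>
      (E.map fun e => (X ((ρ ∘ Fin.castLE ha) e.1, γ' e.2) : MvPolynomial (Fin n × Fin n) F)).prod)]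
    rfl
  simp_rw [h1]
  rw [← Finset.smul_sum]
  rw [OrbitSupport.sum_comp_castLE ha (fun ρ' : Fin a → Fin n => ∑ γ' : Fin b → Fin n,
    (E.map fun e => (X (ρ' e.1, γ' e.2) : MvPolynomial (Fin n × Fin n) F)).prod)]
  rw [smul_smul, mul_comm]

end Padding

/-! ### The machine: short closed expressions from a homomorphism-polynomial span -/

section Machine

variable {n : ℕ}

/-- The multiset of edges with prescribed multiplicities `m : Fin r × Fin s → Fin (d+1)` has `≤ r·s·d`
edges. [folklore] -/
theorem card_toMultiset_le {r s d : ℕ} (m : Fin r × Fin s → Fin (d + 1)) :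
    Multiset.card (Finsupp.toMultiset (Finsupp.equivFunOnFinite.symm fun ij => (m ij : ℕ))) ≤ r * s * d := by
  classical
  rw [Finsupp.card_toMultiset, Finsupp.sum_fintype _ _ (fun _ => rfl)]
  calc ∑ ij : Fin r × Fin s, (id ((Finsupp.equivFunOnFinite.symm fun ij => (m ij : ℕ)) ij) : ℕ)
      ≤ ∑ _ij : Fin r × Fin s, d := Finset.sum_le_sum fun ij _ => by
        simp only [Finsupp.coe_equivFunOnFinite_symm, id]
        have := (m ij).isLt
        omega
    _ = r * s * d := by simp [Finset.sum_const, Finset.card_univ, Fintype.card_prod, Fintype.card_fin]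

/-- **The machine.**  If `p` lies in the `ℂ`-span of the homomorphism polynomials of patterns with `≤ r` row
vertices, `≤ s` column vertices and `≤ d` edges (`n ≥ 1`), then `p = close e` for an expression `e` with `r` row
labels, `s` column labels and `|e| ≤ (d+1)^{rs} · (2·rsd + 4) + 1`. [folklore] -/
theorem exists_short_close_of_mem_span (hn : 1 ≤ n) (p : MvPolynomial (Fin n × Fin n) ℂ) {r s d : ℕ}
    (hmem : p ∈ Submodule.span ℂ {q : MvPolynomial (Fin n × Fin n) ℂ | ∃ (a b : ℕ) (E : Multiset (Fin a × Fin b)),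
      a ≤ r ∧ b ≤ s ∧ Multiset.card E ≤ d ∧ q = homPoly E n ℂ}) :
    ∃ e : PatternExpr ℂ r s, e.length ≤ (d + 1) ^ (r * s) * (2 * (r * s * d) + 4) + 1 ∧ e.close n = p := by
  classical
  -- the finite family of candidate patterns: multiplicity functions `Fin r × Fin s → Fin (d+1)`
  set Φ : (Fin r × Fin s → Fin (d + 1)) → MvPolynomial (Fin n × Fin n) ℂ := fun m =>
    homPoly (Finsupp.toMultiset (Finsupp.equivFunOnFinite.symm fun ij => (m ij : ℕ))) n ℂ with hΦ
  -- every generator is a scalar multiple of a member of the family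
  have hsub : {q : MvPolynomial (Fin n × Fin n) ℂ | ∃ (a b : ℕ) (E : Multiset (Fin a × Fin b)),
      a ≤ r ∧ b ≤ s ∧ Multiset.card E ≤ d ∧ q = homPoly E n ℂ} ⊆ (Submodule.span ℂ (Set.range Φ) : Set _) := by
    rintro q ⟨a, b, E, ha, hb, hE, rfl⟩
    set E' : Multiset (Fin r × Fin s) := E.map fun e => (Fin.castLE ha e.1, Fin.castLE hb e.2) with hE'
    have hcardE' : Multiset.card E' = Multiset.card E := by simp [hE']
    -- the multiplicity function of `E'`
    set m : Fin r × Fin s → Fin (d + 1) := fun ij =>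
      ⟨E'.count ij, Nat.lt_succ_of_le ((Multiset.count_le_card ij E').trans (hcardE'.le.trans hE))⟩ with hm
    have hEm : Finsupp.toMultiset (Finsupp.equivFunOnFinite.symm fun ij => (m ij : ℕ)) = E' := by
      ext ij
      rw [Finsupp.count_toMultiset, Finsupp.coe_equivFunOnFinite_symm]
    have hΦm : Φ m = ((n ^ (r - a) * n ^ (s - b) : ℕ) : ℂ) • homPoly E n ℂ := by
      simp only [hΦ]
      rw [hEm, hE', homPoly_map_castLE, Nat.cast_smul_eq_nsmul]
    have hN : ((n ^ (r - a) * n ^ (s - b) : ℕ) : ℂ) ≠ 0 := by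
      have h0 : 0 < n ^ (r - a) * n ^ (s - b) := by
        have : 0 < n := hn
        positivity
      exact Nat.cast_ne_zero.2 h0.ne'
    have : homPoly E n ℂ = (((n ^ (r - a) * n ^ (s - b) : ℕ) : ℂ))⁻¹ • Φ m := by
      rw [hΦm, smul_smul, inv_mul_cancel₀ hN, one_smul]
    rw [SetLike.mem_coe, this]
    exact Submodule.smul_mem _ _ (Submodule.subset_span (Set.mem_range_self m))
  have hp : p ∈ Submodule.span ℂ (Set.range Φ) := (Submodule.span_le.2 hsub) hmem
  obtain ⟨c, hc⟩ := (Submodule.mem_span_range_iff_exists_fun ℂ).1 hp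
  -- one short expression per member of the family
  have ht : ∀ m : Fin r × Fin s → Fin (d + 1), ∃ t : PatternExpr ℂ r s,
      t.length ≤ 2 * (r * s * d) + 1 ∧ t.close n = Φ m := by
    intro m
    obtain ⟨t, ht, hclose⟩ := exists_close_eq_homPoly (F := ℂ)
      (Finsupp.toMultiset (Finsupp.equivFunOnFinite.symm fun ij => (m ij : ℕ))) n
    exact ⟨t, ht.trans (by have := card_toMultiset_le m; omega), hclose⟩
  choose t ht hclose using ht
  obtain ⟨e, he, hlen⟩ := exists_close_eq_sum_smul Finset.univ c t n
  refine ⟨e, ?_, ?_⟩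
  · rw [hlen]
    calc ∑ m : Fin r × Fin s → Fin (d + 1), ((t m).length + 3) + 1
        ≤ ∑ _m : Fin r × Fin s → Fin (d + 1), (2 * (r * s * d) + 4) + 1 := by
          refine Nat.add_le_add_right (Finset.sum_le_sum fun m _ => ?_) 1
          have := ht m
          omega
      _ = (d + 1) ^ (r * s) * (2 * (r * s * d) + 4) + 1 := by
          simp [Finset.sum_const, Finset.card_univ, Fintype.card_prod, Fintype.card_fin]
  · rw [he, ← hc]
    exact Finset.sum_congr rfl fun m _ => by rw [hclose]

/-- **Every matrix-symmetric polynomial of degree `≤ d` is a SHORT closed expression with `d + d` labels**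
(`n ≥ 1`): length `≤ (d+1)^{d·d} · (2d³ + 4) + 1`. [cite: DwivediPagoSeppelt2026, §8] -/
theorem exists_short_close_of_matrixSymmetric (hn : 1 ≤ n) (p : MvPolynomial (Fin n × Fin n) ℂ)
    (hp : ∀ σ τ : Equiv.Perm (Fin n), rename (fun ij : Fin n × Fin n => (σ ij.1, τ ij.2)) p = p)
    {d : ℕ} (hd : p.totalDegree ≤ d) :
    ∃ e : PatternExpr ℂ d d, e.length ≤ (d + 1) ^ (d * d) * (2 * (d * d * d) + 4) + 1 ∧ e.close n = p := by
  refine exists_short_close_of_mem_span hn p (Submodule.span_mono ?_ (HomSpan.mem_span_homPoly_of_matrixSymmetric p hp))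
  rintro q ⟨a, b, E, ha, hb, hE, rfl⟩
  exact ⟨a, b, E, ha.trans hd, hb.trans hd, hE.trans hd, rfl⟩

/-- **Every matrix-symmetric polynomial whose monomials use `≤ r` rows and `≤ s` columns is a SHORT closed
expression with `r + s` labels** (`n ≥ 1`, `d ≥ deg p`): length `≤ (d+1)^{rs} · (2rsd + 4) + 1`.
[cite: DwivediPagoSeppelt2026, §8] -/
theorem exists_short_close_of_rows_cols_le (hn : 1 ≤ n) (p : MvPolynomial (Fin n × Fin n) ℂ)
    (hp : ∀ σ τ : Equiv.Perm (Fin n), rename (fun ij : Fin n × Fin n => (σ ij.1, τ ij.2)) p = p)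
    {r s d : ℕ} (hr : ∀ D ∈ p.support, (D.support.image Prod.fst).card ≤ r)
    (hs : ∀ D ∈ p.support, (D.support.image Prod.snd).card ≤ s) (hd : p.totalDegree ≤ d) :
    ∃ e : PatternExpr ℂ r s, e.length ≤ (d + 1) ^ (r * s) * (2 * (r * s * d) + 4) + 1 ∧ e.close n = p := by
  refine exists_short_close_of_mem_span hn p
    (Submodule.span_mono ?_ (TwoSortedPassage.mem_span_homPoly_of_rows_cols_le p hp hr hs))
  rintro q ⟨a, b, E, ha, hb, hE, rfl⟩
  exact ⟨a, b, E, ha, hb, hE.trans hd, rfl⟩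

end Machine

end ShortClose

end Summit.ValiantsHypothesis.ValiantsHypothesis.Theorems

end
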